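import Mathlib
import HarnessLib
import Summits.ValiantsHypothesis.ValiantsHypothesis.Theorems.LacunarySymmetroidMatrixDescartesOsculationLawRankThreeColumnDegenerate
import Summits.ValiantsHypothesis.ValiantsHypothesis.Theorems.LacunarySymmetroidMatrixDescartesOsculationLawThreeKThreeZero
import Summits.ValiantsHypothesis.ValiantsHypothesis.Theorems.LacunarySymmetroidMatrixDescartesOsculationLawCuspCubicNonMonicCount
import Summits.ValiantsHypothesis.ValiantsHypothesis.Theorems.LacunarySymmetroidMatrixDescartesOsculationLawCuspCubicNonMonicSupportBound
import Summits.ValiantsHypothesis.ValiantsHypothesis.Theorems.LacunarySymmetroidMatrixDescartesOsculationLawCuspCubicNonMonicSupport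
import Summits.ValiantsHypothesis.ValiantsHypothesis.Theorems.LacunarySymmetroidMatrixDescartesOsculationLawCuspCubicNonMonicAlgebra
import Summits.ValiantsHypothesis.ValiantsHypothesis.Theorems.LacunarySymmetroidMatrixDescartesOsculationLawCuspCubicNonMonicReductionPoly

/-!
# ValiantsHypothesis / LacunarySymmetroid — crux `MatrixDescartes` (stmt-ValiantsHypothesis-18050, V1),
# line «osculation-law»: the RANK-THREE COLUMN of the osculation law

For the splitting `(r, s) = (3, s)` of `OsculationLawAt (s+3) K ·` — a RANK-THREE semidefinite letter `b·(I₃ ⊕ 0)`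
inserted into a symmetric pencil of ANY size `m = s + 3` — the letter is the cubic `a₃b³ + a₂b² + a₁b + a₀`
(`OsculationLetter.insertionPoly_rank_card`: `a₃ = det G₂₂`, `a₂`, `a₁` = sums of principal cofactors, `a₀ = det G`,
supports `s•E … (s+3)•E`, real-rooted at every `t`: `…RankLetterSplitsAt` / `prod_roots_pencil_rank_card`).  The
generic half `a₃ ≢ 0` is val-lit-p6 g13's non-monic cubic count `OsculationCuspCubic.nonmonic_cubic_curve_ncard_le`
(p613747) fed through its algebra (`eval_Psi3`, `eval_logHessian_Psi3`, `hessval_vertical`; the reduction `OsculationRankThree.hess_pseudo_reduce_poly3` is the staged re-file of p6's identity)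
and symbolic monomial counts (`supp_R2n/R1n/R0n`, `bound_le_pow_gen`: `≤ 20 K^(47s+41)` for `s ≥ 1`); the degenerate
half `a₃ ≡ 0` is `OsculationRankThree.osc_three_s_of_top_zero` (`≤ 5 K^(15(s+1)+12)`); `s = 0` is the landed
`OsculationThreeK.osc_three_zero` (`≤ 17 K⁴¹`).  Hence the explicit column, for every `s`, `K`:

  `osc_three_s (s K d S) : … (osculation set finite) → #osc ≤ 20 · K ^ (47 s + 41)`.

With the rank-0/1/2 columns every splitting with `r ≤ 3` of every format is now bounded polynomially in `K`.
Honest framing: a located COLUMN of an UNREGISTERED V1 law line with a Descartes ceiling (not inside the law's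
envelope uniformly in `m`); `r ≥ 4`, `OsculationLaw`, `PeelInequality`, `stub_recursion`, `MatrixDescartes`,
Conjecture B and `VP ≠ VNP` stay OPEN / NOT proved.  No definitions, no named facts; Mathlib + tree osculation files.
-/

-- `Summit.ValiantsHypothesis.ValiantsHypothesis.…` is the tree's mandated single-conjunct layout (Sub = Summit).
set_option linter.dupNamespace false

-- the count and the reduction carry explicit polynomials of ≈ 200 terms (deep terms)
set_option maxRecDepth 100000

noncomputable section

namespace Summit.ValiantsHypothesis.ValiantsHypothesis.Theorems.LacunarySymmetroidMatrixDescartes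

open Polynomial Set
open scoped BigOperators Pointwise

namespace OsculationRankThree

open OsculationCusp OsculationTwoK OsculationLetter OsculationRankTwo OsculationCuspCubic

/-- Power bookkeeping for the three branches. [folklore] -/
theorem branch_arith (K s : ℕ) :
    17 * K ^ 41 ≤ 20 * K ^ (47 * 0 + 41) ∧ 5 * K ^ (15 * (s + 1) + 12) ≤ 20 * K ^ (47 * s + 41) := by
  refine ⟨by simpa using Nat.mul_le_mul_right (K ^ 41) (by norm_num : 17 ≤ 20), ?_⟩
  have h := OsculationRankTwo.pow_le_pow_of_le' K (i := 15 * (s + 1) + 12) (j := 47 * s + 41) (by omega) (by omega)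
  omega

-- the proof instantiates the cubic reduction and count with the explicit `R₂, R₁, R₀`: slow elaboration.
set_option maxHeartbeats 3200000 in
/-- **The rank-three column of the osculation law.**  For every `s`, `K`, every exponent vector `d` and every
symmetric block pencil `S : Fin K → Matrix (Fin 3 ⊕ Fin s) (Fin 3 ⊕ Fin s) ℝ`: if the osculation set of the spectral
curve `det(Σ_l t^(d l) S_l + b·(I₃ ⊕ 0)) = 0` (the line's `osculationSet d S`, UNFOLDED verbatim) is finite, it has
at most `20 · K^(47 s + 41)` points — the `(3, s)` splitting of `OsculationLawAt (s + 3) K (20 K^(47s+41))`. -/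
theorem osc_three_s (s K : ℕ) (d : Fin K → ℕ) (S : Fin K → Matrix (Fin 3 ⊕ Fin s) (Fin 3 ⊕ Fin s) ℝ)
    (hS : ∀ l, (S l).IsSymm) (hfin : {p : Fin 2 → ℝ | 0 < p 0 ∧ 0 < p 1 ∧ MvPolynomial.eval p (∑ l, (MvPolynomial.X (0 : Fin 2) : MvPolynomial (Fin 2) ℝ) ^ d l •
              (S l).map (MvPolynomial.C : ℝ →+* MvPolynomial (Fin 2) ℝ)
            + (MvPolynomial.X (1 : Fin 2) : MvPolynomial (Fin 2) ℝ) •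
              (Matrix.fromBlocks 1 0 0 0 : Matrix (Fin 3 ⊕ Fin s) (Fin 3 ⊕ Fin s) ℝ).map
                (MvPolynomial.C : ℝ →+* MvPolynomial (Fin 2) ℝ)).det = 0 ∧
      MvPolynomial.eval p
        (MvPolynomial.X 0 * MvPolynomial.pderiv 0 (MvPolynomial.X 0 * MvPolynomial.pderiv 0 (∑ l, (MvPolynomial.X (0 : Fin 2) : MvPolynomial (Fin 2) ℝ) ^ d l •
              (S l).map (MvPolynomial.C : ℝ →+* MvPolynomial (Fin 2) ℝ)
            + (MvPolynomial.X (1 : Fin 2) : MvPolynomial (Fin 2) ℝ) •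
              (Matrix.fromBlocks 1 0 0 0 : Matrix (Fin 3 ⊕ Fin s) (Fin 3 ⊕ Fin s) ℝ).map
                (MvPolynomial.C : ℝ →+* MvPolynomial (Fin 2) ℝ)).det)
            * (MvPolynomial.X 1 * MvPolynomial.pderiv 1 (∑ l, (MvPolynomial.X (0 : Fin 2) : MvPolynomial (Fin 2) ℝ) ^ d l •
              (S l).map (MvPolynomial.C : ℝ →+* MvPolynomial (Fin 2) ℝ)
            + (MvPolynomial.X (1 : Fin 2) : MvPolynomial (Fin 2) ℝ) •
              (Matrix.fromBlocks 1 0 0 0 : Matrix (Fin 3 ⊕ Fin s) (Fin 3 ⊕ Fin s) ℝ).map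
                (MvPolynomial.C : ℝ →+* MvPolynomial (Fin 2) ℝ)).det) ^ 2
          - 2 * (MvPolynomial.X 0 * MvPolynomial.pderiv 0 (MvPolynomial.X 1 * MvPolynomial.pderiv 1 (∑ l, (MvPolynomial.X (0 : Fin 2) : MvPolynomial (Fin 2) ℝ) ^ d l •
              (S l).map (MvPolynomial.C : ℝ →+* MvPolynomial (Fin 2) ℝ)
            + (MvPolynomial.X (1 : Fin 2) : MvPolynomial (Fin 2) ℝ) •
              (Matrix.fromBlocks 1 0 0 0 : Matrix (Fin 3 ⊕ Fin s) (Fin 3 ⊕ Fin s) ℝ).map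
                (MvPolynomial.C : ℝ →+* MvPolynomial (Fin 2) ℝ)).det))
            * (MvPolynomial.X 0 * MvPolynomial.pderiv 0 (∑ l, (MvPolynomial.X (0 : Fin 2) : MvPolynomial (Fin 2) ℝ) ^ d l •
              (S l).map (MvPolynomial.C : ℝ →+* MvPolynomial (Fin 2) ℝ)
            + (MvPolynomial.X (1 : Fin 2) : MvPolynomial (Fin 2) ℝ) •
              (Matrix.fromBlocks 1 0 0 0 : Matrix (Fin 3 ⊕ Fin s) (Fin 3 ⊕ Fin s) ℝ).map
                (MvPolynomial.C : ℝ →+* MvPolynomial (Fin 2) ℝ)).det) * (MvPolynomial.X 1 * MvPolynomial.pderiv 1 (∑ l, (MvPolynomial.X (0 : Fin 2) : MvPolynomial (Fin 2) ℝ) ^ d l •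
              (S l).map (MvPolynomial.C : ℝ →+* MvPolynomial (Fin 2) ℝ)
            + (MvPolynomial.X (1 : Fin 2) : MvPolynomial (Fin 2) ℝ) •
              (Matrix.fromBlocks 1 0 0 0 : Matrix (Fin 3 ⊕ Fin s) (Fin 3 ⊕ Fin s) ℝ).map
                (MvPolynomial.C : ℝ →+* MvPolynomial (Fin 2) ℝ)).det)
          + MvPolynomial.X 1 * MvPolynomial.pderiv 1 (MvPolynomial.X 1 * MvPolynomial.pderiv 1 (∑ l, (MvPolynomial.X (0 : Fin 2) : MvPolynomial (Fin 2) ℝ) ^ d l •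
              (S l).map (MvPolynomial.C : ℝ →+* MvPolynomial (Fin 2) ℝ)
            + (MvPolynomial.X (1 : Fin 2) : MvPolynomial (Fin 2) ℝ) •
              (Matrix.fromBlocks 1 0 0 0 : Matrix (Fin 3 ⊕ Fin s) (Fin 3 ⊕ Fin s) ℝ).map
                (MvPolynomial.C : ℝ →+* MvPolynomial (Fin 2) ℝ)).det)
            * (MvPolynomial.X 0 * MvPolynomial.pderiv 0 (∑ l, (MvPolynomial.X (0 : Fin 2) : MvPolynomial (Fin 2) ℝ) ^ d l •
              (S l).map (MvPolynomial.C : ℝ →+* MvPolynomial (Fin 2) ℝ)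
            + (MvPolynomial.X (1 : Fin 2) : MvPolynomial (Fin 2) ℝ) •
              (Matrix.fromBlocks 1 0 0 0 : Matrix (Fin 3 ⊕ Fin s) (Fin 3 ⊕ Fin s) ℝ).map
                (MvPolynomial.C : ℝ →+* MvPolynomial (Fin 2) ℝ)).det) ^ 2) = 0}.Finite) :
    {p : Fin 2 → ℝ | 0 < p 0 ∧ 0 < p 1 ∧ MvPolynomial.eval p (∑ l, (MvPolynomial.X (0 : Fin 2) : MvPolynomial (Fin 2) ℝ) ^ d l •
              (S l).map (MvPolynomial.C : ℝ →+* MvPolynomial (Fin 2) ℝ)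
            + (MvPolynomial.X (1 : Fin 2) : MvPolynomial (Fin 2) ℝ) •
              (Matrix.fromBlocks 1 0 0 0 : Matrix (Fin 3 ⊕ Fin s) (Fin 3 ⊕ Fin s) ℝ).map
                (MvPolynomial.C : ℝ →+* MvPolynomial (Fin 2) ℝ)).det = 0 ∧
      MvPolynomial.eval p
        (MvPolynomial.X 0 * MvPolynomial.pderiv 0 (MvPolynomial.X 0 * MvPolynomial.pderiv 0 (∑ l, (MvPolynomial.X (0 : Fin 2) : MvPolynomial (Fin 2) ℝ) ^ d l •
              (S l).map (MvPolynomial.C : ℝ →+* MvPolynomial (Fin 2) ℝ)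
            + (MvPolynomial.X (1 : Fin 2) : MvPolynomial (Fin 2) ℝ) •
              (Matrix.fromBlocks 1 0 0 0 : Matrix (Fin 3 ⊕ Fin s) (Fin 3 ⊕ Fin s) ℝ).map
                (MvPolynomial.C : ℝ →+* MvPolynomial (Fin 2) ℝ)).det)
            * (MvPolynomial.X 1 * MvPolynomial.pderiv 1 (∑ l, (MvPolynomial.X (0 : Fin 2) : MvPolynomial (Fin 2) ℝ) ^ d l •
              (S l).map (MvPolynomial.C : ℝ →+* MvPolynomial (Fin 2) ℝ)
            + (MvPolynomial.X (1 : Fin 2) : MvPolynomial (Fin 2) ℝ) •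
              (Matrix.fromBlocks 1 0 0 0 : Matrix (Fin 3 ⊕ Fin s) (Fin 3 ⊕ Fin s) ℝ).map
                (MvPolynomial.C : ℝ →+* MvPolynomial (Fin 2) ℝ)).det) ^ 2
          - 2 * (MvPolynomial.X 0 * MvPolynomial.pderiv 0 (MvPolynomial.X 1 * MvPolynomial.pderiv 1 (∑ l, (MvPolynomial.X (0 : Fin 2) : MvPolynomial (Fin 2) ℝ) ^ d l •
              (S l).map (MvPolynomial.C : ℝ →+* MvPolynomial (Fin 2) ℝ)
            + (MvPolynomial.X (1 : Fin 2) : MvPolynomial (Fin 2) ℝ) •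
              (Matrix.fromBlocks 1 0 0 0 : Matrix (Fin 3 ⊕ Fin s) (Fin 3 ⊕ Fin s) ℝ).map
                (MvPolynomial.C : ℝ →+* MvPolynomial (Fin 2) ℝ)).det))
            * (MvPolynomial.X 0 * MvPolynomial.pderiv 0 (∑ l, (MvPolynomial.X (0 : Fin 2) : MvPolynomial (Fin 2) ℝ) ^ d l •
              (S l).map (MvPolynomial.C : ℝ →+* MvPolynomial (Fin 2) ℝ)
            + (MvPolynomial.X (1 : Fin 2) : MvPolynomial (Fin 2) ℝ) •
              (Matrix.fromBlocks 1 0 0 0 : Matrix (Fin 3 ⊕ Fin s) (Fin 3 ⊕ Fin s) ℝ).map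
                (MvPolynomial.C : ℝ →+* MvPolynomial (Fin 2) ℝ)).det) * (MvPolynomial.X 1 * MvPolynomial.pderiv 1 (∑ l, (MvPolynomial.X (0 : Fin 2) : MvPolynomial (Fin 2) ℝ) ^ d l •
              (S l).map (MvPolynomial.C : ℝ →+* MvPolynomial (Fin 2) ℝ)
            + (MvPolynomial.X (1 : Fin 2) : MvPolynomial (Fin 2) ℝ) •
              (Matrix.fromBlocks 1 0 0 0 : Matrix (Fin 3 ⊕ Fin s) (Fin 3 ⊕ Fin s) ℝ).map
                (MvPolynomial.C : ℝ →+* MvPolynomial (Fin 2) ℝ)).det)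
          + MvPolynomial.X 1 * MvPolynomial.pderiv 1 (MvPolynomial.X 1 * MvPolynomial.pderiv 1 (∑ l, (MvPolynomial.X (0 : Fin 2) : MvPolynomial (Fin 2) ℝ) ^ d l •
              (S l).map (MvPolynomial.C : ℝ →+* MvPolynomial (Fin 2) ℝ)
            + (MvPolynomial.X (1 : Fin 2) : MvPolynomial (Fin 2) ℝ) •
              (Matrix.fromBlocks 1 0 0 0 : Matrix (Fin 3 ⊕ Fin s) (Fin 3 ⊕ Fin s) ℝ).map
                (MvPolynomial.C : ℝ →+* MvPolynomial (Fin 2) ℝ)).det)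
            * (MvPolynomial.X 0 * MvPolynomial.pderiv 0 (∑ l, (MvPolynomial.X (0 : Fin 2) : MvPolynomial (Fin 2) ℝ) ^ d l •
              (S l).map (MvPolynomial.C : ℝ →+* MvPolynomial (Fin 2) ℝ)
            + (MvPolynomial.X (1 : Fin 2) : MvPolynomial (Fin 2) ℝ) •
              (Matrix.fromBlocks 1 0 0 0 : Matrix (Fin 3 ⊕ Fin s) (Fin 3 ⊕ Fin s) ℝ).map
                (MvPolynomial.C : ℝ →+* MvPolynomial (Fin 2) ℝ)).det) ^ 2) = 0}.ncard ≤ 20 * K ^ (47 * s + 41) := by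

  classical
  obtain ⟨h0branch, hdeg⟩ := branch_arith K s
  rcases Nat.eq_zero_or_pos s with rfl | hs
  · exact (OsculationThreeK.osc_three_zero K d S hS hfin).trans h0branch
  have hEK : (Finset.univ.image d).card ≤ K := (Finset.card_image_le).trans (by simp)
  by_cases h3 : (∑ l, (X : ℝ[X]) ^ d l • ((S l).toBlocks₂₂).map Polynomial.C).det = 0
  · exact (osc_three_s_of_top_zero s K d S hS h3 hfin).trans hdeg
  -- the cubic letter `Φ = X₁³·ι a₃ + X₁²·ι a₂ + X₁·ι a₁ + ι a₀`
  have hΦ : (∑ l, (MvPolynomial.X (0 : Fin 2) : MvPolynomial (Fin 2) ℝ) ^ d l •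
              (S l).map (MvPolynomial.C : ℝ →+* MvPolynomial (Fin 2) ℝ)
            + (MvPolynomial.X (1 : Fin 2) : MvPolynomial (Fin 2) ℝ) •
              (Matrix.fromBlocks 1 0 0 0 : Matrix (Fin 3 ⊕ Fin s) (Fin 3 ⊕ Fin s) ℝ).map
                (MvPolynomial.C : ℝ →+* MvPolynomial (Fin 2) ℝ)).det =
      MvPolynomial.X 1 * MvPolynomial.X 1 * MvPolynomial.X 1 * Polynomial.aeval (MvPolynomial.X 0 : MvPolynomial (Fin 2) ℝ) (∑ l, (X : ℝ[X]) ^ d l • ((S l).toBlocks₂₂).map Polynomial.C).det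
        + MvPolynomial.X 1 * MvPolynomial.X 1 * Polynomial.aeval (MvPolynomial.X 0 : MvPolynomial (Fin 2) ℝ)
          (∑ U ∈ (Finset.univ.map Function.Embedding.inl : Finset (Fin 3 ⊕ Fin s)).powersetCard 2,
          (Matrix.of fun i j : Fin 3 ⊕ Fin s => if i ∈ U then (Pi.single i (1 : ℝ[X]) : Fin 3 ⊕ Fin s → ℝ[X]) j
            else (∑ l, (X : ℝ[X]) ^ d l • (S l).map Polynomial.C) i j).det)
        + MvPolynomial.X 1 * Polynomial.aeval (MvPolynomial.X 0 : MvPolynomial (Fin 2) ℝ)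
          (∑ U ∈ (Finset.univ.map Function.Embedding.inl : Finset (Fin 3 ⊕ Fin s)).powersetCard 1,
          (Matrix.of fun i j : Fin 3 ⊕ Fin s => if i ∈ U then (Pi.single i (1 : ℝ[X]) : Fin 3 ⊕ Fin s → ℝ[X]) j
            else (∑ l, (X : ℝ[X]) ^ d l • (S l).map Polynomial.C) i j).det)
        + Polynomial.aeval (MvPolynomial.X 0 : MvPolynomial (Fin 2) ℝ) (∑ l, (X : ℝ[X]) ^ d l • (S l).map Polynomial.C).det := by
    rw [insertionPoly_rank_card 3 s d S, Finset.sum_range_succ, Finset.sum_range_succ, Finset.sum_range_succ,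
      Finset.sum_range_succ, Finset.sum_range_zero, coeff_top 3 s d S, coeff_zero 3 s d S]
    ring
  -- supports of the four coefficients
  have h3s : ((∑ l, (X : ℝ[X]) ^ d l • ((S l).toBlocks₂₂).map Polynomial.C).det).support ⊆ s • Finset.univ.image d :=
    supp_cast (supp_det_pencil d fun l => (S l).toBlocks₂₂) (by simp)
  have h2s : (∑ U ∈ (Finset.univ.map Function.Embedding.inl : Finset (Fin 3 ⊕ Fin s)).powersetCard 2,
          (Matrix.of fun i j : Fin 3 ⊕ Fin s => if i ∈ U then (Pi.single i (1 : ℝ[X]) : Fin 3 ⊕ Fin s → ℝ[X]) j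
            else (∑ l, (X : ℝ[X]) ^ d l • (S l).map Polynomial.C) i j).det).support ⊆ (s + 1) • Finset.univ.image d :=
    supp_cast (supp_coeff_card 3 s d S 2) (by omega)
  have h1s : (∑ U ∈ (Finset.univ.map Function.Embedding.inl : Finset (Fin 3 ⊕ Fin s)).powersetCard 1,
          (Matrix.of fun i j : Fin 3 ⊕ Fin s => if i ∈ U then (Pi.single i (1 : ℝ[X]) : Fin 3 ⊕ Fin s → ℝ[X]) j
            else (∑ l, (X : ℝ[X]) ^ d l • (S l).map Polynomial.C) i j).det).support ⊆ (s + 2) • Finset.univ.image d :=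
    supp_cast (supp_coeff_card 3 s d S 1) (by omega)
  have h0s : ((∑ l, (X : ℝ[X]) ^ d l • (S l).map Polynomial.C).det).support ⊆ (s + 3) • Finset.univ.image d :=
    supp_cast (supp_det_pencil d S) (by simp [Fintype.card_sum, Fintype.card_fin]; omega)
  -- real-rootedness where `a₃(t) ≠ 0`
  have hreal : ∀ t : ℝ, ((∑ l, (X : ℝ[X]) ^ d l • ((S l).toBlocks₂₂).map Polynomial.C).det).eval t ≠ 0 → ∃ μ₁ μ₂ μ₃ : ℝ, ∀ b : ℝ,
      ((∑ l, (X : ℝ[X]) ^ d l • ((S l).toBlocks₂₂).map Polynomial.C).det).eval t * b ^ 3 + (∑ U ∈ (Finset.univ.map Function.Embedding.inl : Finset (Fin 3 ⊕ Fin s)).powersetCard 2,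
          (Matrix.of fun i j : Fin 3 ⊕ Fin s => if i ∈ U then (Pi.single i (1 : ℝ[X]) : Fin 3 ⊕ Fin s → ℝ[X]) j
            else (∑ l, (X : ℝ[X]) ^ d l • (S l).map Polynomial.C) i j).det).eval t * b ^ 2
        + (∑ U ∈ (Finset.univ.map Function.Embedding.inl : Finset (Fin 3 ⊕ Fin s)).powersetCard 1,
          (Matrix.of fun i j : Fin 3 ⊕ Fin s => if i ∈ U then (Pi.single i (1 : ℝ[X]) : Fin 3 ⊕ Fin s → ℝ[X]) j
            else (∑ l, (X : ℝ[X]) ^ d l • (S l).map Polynomial.C) i j).det).eval t * b + ((∑ l, (X : ℝ[X]) ^ d l • (S l).map Polynomial.C).det).eval t =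
      ((∑ l, (X : ℝ[X]) ^ d l • ((S l).toBlocks₂₂).map Polynomial.C).det).eval t * ((b - μ₁) * (b - μ₂) * (b - μ₃)) := by
    intro t hD
    obtain ⟨μ, hμ⟩ := prod_roots_pencil_rank_card 3 s d S hS t hD
    refine ⟨μ 0, μ 1, μ 2, fun b => ?_⟩
    have := hμ b
    rw [Finset.sum_range_succ, Finset.sum_range_succ, Finset.sum_range_succ, Finset.sum_range_succ,
      Finset.sum_range_zero, coeff_top 3 s d S, coeff_zero 3 s d S, Fin.prod_univ_three] at this
    linear_combination this
  -- the count (R₂, R₁, R₀ are inferred from `hess_pseudo_reduce_poly3` inside the `hout` term)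
  refine (nonmonic_cubic_curve_ncard_le _ _ _ _ _ _ _ _ h3
    (fun p hp => by
      obtain ⟨h0, h1, hΦ0, hH0⟩ := hp
      rw [hΦ, eval_Psi3] at hΦ0
      rw [eval_logHessian_Psi3 _ _ _ _ _ hΦ] at hH0
      have hred := hess_pseudo_reduce_poly3 _ _ _ _ (p 0) (p 1) hΦ0
      rw [hH0, mul_zero] at hred
      exact ⟨h0, h1, hΦ0, hred.symm⟩)
    (fun t b ht hb ha3 hΨ0 hR => by
      refine ⟨by simpa using ht, by simpa using hb, ?_, ?_⟩
      · rw [hΦ, eval_Psi3]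
        simpa using hΨ0
      · rw [eval_logHessian_Psi3 _ _ _ _ _ hΦ]
        simp only [Matrix.cons_val_zero, Matrix.cons_val_one]
        have hred := hess_pseudo_reduce_poly3 _ _ _ _ t b hΨ0
        rw [hR] at hred
        exact (mul_eq_zero.1 hred).resolve_left (pow_ne_zero 6 ha3))
    (fun t ht e3 e2 e1 e0 b hb => by
      refine ⟨by simpa using ht, by simpa using hb, ?_, ?_⟩
      · rw [hΦ, eval_Psi3]
        simp only [Matrix.cons_val_zero, Matrix.cons_val_one, e3, e2, e1, e0]
        ring
      · rw [eval_logHessian_Psi3 _ _ _ _ _ hΦ]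
        simp only [Matrix.cons_val_zero, Matrix.cons_val_one]
        exact hessval_vertical _ _ _ _ t b e3 e2 e1)
    hreal hfin).trans ?_
  exact bound_le_pow_gen hs hEK h3s h2s h1s h0s (supp_R2n _ _ _ _ _ s h3s h2s h1s h0s)
    (supp_R1n _ _ _ _ _ s h3s h2s h1s h0s) (supp_R0n _ _ _ _ _ s h3s h2s h1s h0s)

end OsculationRankThree

end Summit.ValiantsHypothesis.ValiantsHypothesis.Theorems.LacunarySymmetroidMatrixDescartes
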